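import Literature.NumberTheory.LFunctions.TaoLogChowla
import Literature.NumberTheory.LFunctions.TaoLogElliottReduction
import HarnessLib

/-!
# Tao's logarithmically averaged two-point Chowla theorem, Möbius form: reduction layer

Top of the proof DAG of the named fact

* `Literature.NumberTheory.Sieve.tao_log_chowla_moebius` (parity.S21; Tao, Forum Math. Pi 4 (2016) e8, §1, the
  paragraph following Remark 1.6): for every shift `h ≥ 1`,
  `∑_{n ≤ x} μ(n) μ(n + h) / n = o(log x)`.

Source (arXiv:1509.05422, §1, after Remark 1.6): "Corollary 1.5 also implies the asymptotic
`∑_{n ≤ x} g₁(n) g₂(n+1) / n = o(log x)` as `x → ∞` when `g₁, g₂` are multiplicative functions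
bounded by `1`, and at least one of `g₁, g₂` is equal to the Möbius function `μ`. Thus for instance
one has `∑_{n ≤ x} μ(n) μ(n+1) / n, … = o(log x)`. … the first estimate is new."  A general shift
`h ≥ 1` is the case `a₁ = a₂ = 1`, `b₁ = 0`, `b₂ = h` (`a₁ b₂ - a₂ b₁ = h ≠ 0`) of Corollary 1.5,
itself the asymptotic form of Theorem 1.3 (vendored as the named fact
`Literature.NumberTheory.LFunctions.tao_log_averaged_elliott_two`).  The only property of `μ` needed beyond `1`-bounded
multiplicativity is hypothesis (1.6) of Theorem 1.3 (non-pretentiousness uniformly in `q ≤ A`,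
`|t| ≤ A x`); since the Granville–Soundararajan distance `𝔻(g, χ(n) n^{it}; x)²` only involves the
values `g(p)` at primes and `μ(p) = λ(p) = -1`, hypothesis (1.6) for `μ` is *literally* hypothesis
(1.6) for `λ` (`Literature.NumberTheory.LFunctions.Tao2016_liouvilleNonpretentious`, proved in `TaoLogChowla` from
Matomäki–Radziwiłł–Tao 2015, (1.12)).

Contents (all proved; no new named facts are introduced):
* `Literature.NumberTheory.LFunctions.moebius_complex_apply_prime`, `Literature.NumberTheory.LFunctions.norm_moebius_complex_le_one`,
  `Literature.NumberTheory.LFunctions.isMultiplicative_moebius_complex` — `μ` as a complex arithmetic function.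
* `Literature.NumberTheory.LFunctions.pretentiousDistSq_moebius_eq_liouville` — `𝔻(μ, g; x)² = 𝔻(λ, g; x)²`.
* `Literature.NumberTheory.LFunctions.Tao2016_moebiusNonpretentious` — hypothesis (1.6) of Tao's Theorem 1.3 for `μ` at every
  level `A` (a `Prop`, the `μ`-twin of `Literature.NumberTheory.LFunctions.Tao2016_liouvilleNonpretentious`), with
  `Literature.NumberTheory.LFunctions.Tao2016_moebiusNonpretentious_iff` (PROVED: it is equivalent to the `λ` statement) and
  `Literature.NumberTheory.LFunctions.Tao2016_moebiusNonpretentious_of_MRT` (PROVED from MRT (1.12)).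
* `Literature.NumberTheory.LFunctions.tao_log_chowla_moebius_of_elliott` — PROVED: Theorem 1.3
  (`tao_log_averaged_elliott_two`) and `Tao2016_liouvilleNonpretentious` imply
  `Literature.NumberTheory.Sieve.tao_log_chowla_moebius`.
* `Literature.NumberTheory.LFunctions.tao_log_chowla_moebius_of_facts` — PROVED: the two named facts
  `tao_log_averaged_elliott_two` (Tao 2016, Thm 1.3) and
  `MatomakiRadziwillTao2015_liouvilleDistLowerBound` (MRT 2015, (1.12)) imply the Möbius fact;
  `Literature.NumberTheory.LFunctions.tao_log_chowla_moebius_of_theorem23` — the same from the deeper frontier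
  `Tao2016_theorem23` + `Tao2016_section2_reduction` + MRT (1.12).

Thus `tao_log_chowla_moebius` has exactly the same open leaves as `tao_log_chowla_liouville`.

## References
* T. Tao, *The logarithmically averaged Chowla and Elliott conjectures for two-point
  correlations*, Forum Math. Pi 4 (2016), e8; arXiv:1509.05422. Theorem 1.3, Corollary 1.5, and
  §1, paragraph following Remark 1.6 (the Möbius consequences); §2, first paragraph.
* K. Matomäki, M. Radziwiłł, T. Tao, *An averaged form of Chowla's conjecture*, Algebra & Number
  Theory 9 (2015), 2167–2196; arXiv:1503.05121, (1.12).

## Design choices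
* The Möbius function as a complex arithmetic function is the coercion
  `(ArithmeticFunction.moebius : ArithmeticFunction ℂ)` of Mathlib's `ℤ`-valued `μ`; no new
  definition.
* `Tao2016_moebiusNonpretentious` is spelled exactly like `Tao2016_liouvilleNonpretentious` (and
  like the hypothesis of `tao_log_averaged_elliott_two`) with `μ` in place of `λ`, so that it can be
  fed to Theorem 1.3 verbatim.
-/

open Filter Asymptotics Finset Complex

namespace Literature.NumberTheory.LFunctions

/-! ### The Möbius function as a complex arithmetic function: basic facts -/

/-- `μ(p) = -1` at a prime `p` (as a complex number). [folklore] -/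
theorem moebius_complex_apply_prime {p : ℕ} (hp : p.Prime) :
    (ArithmeticFunction.moebius : ArithmeticFunction ℂ) p = -1 := by
  rw [ArithmeticFunction.intCoe_apply, ArithmeticFunction.moebius_apply_prime hp]
  simp

/-- `|μ(n)| ≤ 1` (as a complex number). [folklore] -/
theorem norm_moebius_complex_le_one (n : ℕ) :
    ‖(ArithmeticFunction.moebius : ArithmeticFunction ℂ) n‖ ≤ 1 := by
  rw [ArithmeticFunction.intCoe_apply]
  rcases ArithmeticFunction.moebius_eq_or n with h | h | h <;> simp [h]

/-- The complex Möbius function is multiplicative. [folklore] -/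
theorem isMultiplicative_moebius_complex :
    (ArithmeticFunction.moebius : ArithmeticFunction ℂ).IsMultiplicative :=
  ArithmeticFunction.isMultiplicative_moebius.intCast

/-- `μ` and `λ` agree at primes (as complex arithmetic functions): `μ(p) = λ(p) = -1`.
[folklore] -/
theorem moebius_complex_apply_prime_eq_liouville {p : ℕ} (hp : p.Prime) :
    (ArithmeticFunction.moebius : ArithmeticFunction ℂ) p =
      (ArithmeticFunction.liouville : ArithmeticFunction ℂ) p := by
  rw [moebius_complex_apply_prime hp, liouville_complex_apply_prime hp]

/-- **Pretentious distances from `μ` and from `λ` coincide**: `𝔻(μ, g; x)² = 𝔻(λ, g; x)²` for every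
`g : ℕ → ℂ` and every height `x`, because the Granville–Soundararajan distance only involves values
at primes, where `μ = λ`. (Tao 2016, §1 after Remark 1.6; Matomäki–Radziwiłł–Tao 2015, §1.)
[folklore] -/
theorem pretentiousDistSq_moebius_eq_liouville (g : ℕ → ℂ) (x : ℝ) :
    Sieve.pretentiousDistSq (ArithmeticFunction.moebius : ArithmeticFunction ℂ) g x =
      Sieve.pretentiousDistSq (ArithmeticFunction.liouville : ArithmeticFunction ℂ) g x := by
  unfold Sieve.pretentiousDistSq
  refine Finset.sum_congr rfl fun p hp => ?_
  rw [moebius_complex_apply_prime_eq_liouville (Nat.mem_primesLE.1 hp).2]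

/-! ### `μ` satisfies the hypothesis of Tao's Theorem 1.3 -/

/-- **`μ` is non-pretentious in the sense of Tao 2016, hypothesis (1.6) of Theorem 1.3** (Tao,
Forum Math. Pi 4 (2016) e8, §1, paragraph following Remark 1.6: Corollary 1.5 applies "when `g₁, g₂`
are multiplicative functions bounded by `1`, and at least one of `g₁, g₂` is equal to the Möbius
function `μ`", i.e. `μ` satisfies the non-pretentiousness hypothesis, exactly as `λ` does since
`μ(p) = λ(p)`). Statement: for every `A`, for all sufficiently large `x`,
`𝔻(μ, χ(n) n^{it}; x)² ≥ A` for all moduli `1 ≤ q ≤ A`, all Dirichlet characters `χ` mod `q` and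
all `|t| ≤ A x` — the hypothesis of `Literature.NumberTheory.LFunctions.tao_log_averaged_elliott_two` for `g₁ = μ`. Equivalent
to `Literature.NumberTheory.LFunctions.Tao2016_liouvilleNonpretentious` (`Tao2016_moebiusNonpretentious_iff`) and hence proved
from MRT (1.12) (`Tao2016_moebiusNonpretentious_of_MRT`).
[cite: TaoFMP2016, §1, paragraph after Remark 1.6 (hypothesis (1.6)/(1.8) for μ)] -/
def Tao2016_moebiusNonpretentious : Prop :=
  ∀ A : ℝ, ∀ᶠ x : ℝ in atTop,
    ∀ (q : ℕ) (χ : DirichletCharacter ℂ q) (t : ℝ), 1 ≤ q → (q : ℝ) ≤ A → |t| ≤ A * x →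
      A ≤ Sieve.pretentiousDistSq (ArithmeticFunction.moebius : ArithmeticFunction ℂ)
        (Sieve.twistedChar χ t) x

/-- Hypothesis (1.6) for `μ` is *the same statement* as hypothesis (1.6) for `λ`, since
`𝔻(μ, ·; x)² = 𝔻(λ, ·; x)²`. [cite: TaoFMP2016, §1, paragraph after Remark 1.6] -/
theorem Tao2016_moebiusNonpretentious_iff :
    Tao2016_moebiusNonpretentious ↔ Tao2016_liouvilleNonpretentious := by
  simp only [Tao2016_moebiusNonpretentious, Tao2016_liouvilleNonpretentious,
    pretentiousDistSq_moebius_eq_liouville]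

/-- **MRT (1.12) ⇒ `μ` satisfies Tao's hypothesis (1.6)** (through the `λ` statement
`Literature.NumberTheory.LFunctions.Tao2016_liouvilleNonpretentious_of_MRT`). [cite: TaoFMP2016, §1, paragraph after Remark 1.6] -/
theorem Tao2016_moebiusNonpretentious_of_MRT
    (h : MatomakiRadziwillTao2015_liouvilleDistLowerBound) : Tao2016_moebiusNonpretentious :=
  Tao2016_moebiusNonpretentious_iff.2 (Tao2016_liouvilleNonpretentious_of_MRT h)

/-! ### Theorem 1.3 + non-pretentiousness ⇒ the Möbius two-point log-Chowla estimate -/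

/-- **Tao 2016, Theorem 1.3 ⇒ `∑_{n ≤ x} μ(n) μ(n+h) / n = o(log x)` (parity.S21, Möbius form).**
The logarithmically averaged non-asymptotic Elliott theorem `Literature.NumberTheory.LFunctions.tao_log_averaged_elliott_two`
(Tao 2016, Thm 1.3), applied with `g₁ = g₂ = μ`, `a₁ = a₂ = 1`, `b₁ = 0`, `b₂ = h` and `ω = x` —
legitimate once `μ` satisfies hypothesis (1.6), which is the `λ` statement
`Tao2016_liouvilleNonpretentious` because `μ = λ` at primes — gives
`|∑_{1 < n ≤ x} μ(n) μ(n+h) / n| ≤ ε log x` for `x` large; the term `n = 1` is at most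
`1 = o(log x)`. (Tao 2016, §1 after Remark 1.6: "Corollary 1.5 also implies the asymptotic
`∑_{n ≤ x} g₁(n) g₂(n+1)/n = o(log x)` … when at least one of `g₁, g₂` is equal to `μ`"; §2, first
paragraph: Corollary 1.5 is a corollary of Theorem 1.3.)
[cite: TaoFMP2016, §1, paragraph after Remark 1.6; Theorem 1.3] -/
theorem tao_log_chowla_moebius_of_elliott (hE : tao_log_averaged_elliott_two)
    (hL0 : Tao2016_liouvilleNonpretentious) : Sieve.tao_log_chowla_moebius := by
  intro h hh
  refine Asymptotics.isLittleO_iff.2 fun c hc => ?_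
  have hab : 1 * h ≠ 1 * 0 := by omega
  obtain ⟨A₀, hA₀⟩ := hE 1 1 0 h le_rfl le_rfl hab (c / 2) (half_pos hc)
  set A : ℝ := max A₀ 1 with hA
  set M : ArithmeticFunction ℂ := (ArithmeticFunction.moebius : ArithmeticFunction ℂ) with hM
  have h1 : ∀ᶠ x : ℕ in atTop, ∀ (q : ℕ) (χ : DirichletCharacter ℂ q) (t : ℝ), 1 ≤ q →
      (q : ℝ) ≤ A → |t| ≤ A * (x : ℝ) → A ≤ Sieve.pretentiousDistSq M (Sieve.twistedChar χ t) (x : ℝ) := by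
    filter_upwards [tendsto_natCast_atTop_atTop.eventually (hL0 A)] with x hx q χ t hq hqA ht
    rw [hM, pretentiousDistSq_moebius_eq_liouville]
    exact hx q χ t hq hqA ht
  have h2 : ∀ᶠ x : ℕ in atTop, A ≤ (x : ℝ) :=
    tendsto_natCast_atTop_atTop.eventually (eventually_ge_atTop A)
  have h3 : ∀ᶠ x : ℕ in atTop, 2 / c ≤ Real.log (x : ℝ) :=
    (Real.tendsto_log_atTop.comp tendsto_natCast_atTop_atTop).eventually (eventually_ge_atTop _)
  filter_upwards [h1, h2, h3, eventually_ge_atTop 1] with x hx1 hx2 hx3 hx4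
  have hx0 : (0 : ℝ) < x := by exact_mod_cast hx4
  have key := hA₀ A (le_max_left _ _) x x hx2 le_rfl M M isMultiplicative_moebius_complex
    isMultiplicative_moebius_complex norm_moebius_complex_le_one norm_moebius_complex_le_one hx1
  rw [div_self hx0.ne', Nat.floor_one, Nat.floor_natCast] at key
  -- identify the complex sum with the real one
  have hcast : (∑ n ∈ Ioc 1 x, M (1 * n + 0) * M (1 * n + h) / (n : ℂ))
      = ((∑ n ∈ Ioc 1 x, (ArithmeticFunction.moebius n *
          ArithmeticFunction.moebius (n + h) : ℝ) / n : ℝ) : ℂ) := by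
    rw [hM]
    push_cast
    refine Finset.sum_congr rfl fun n _ => ?_
    simp only [ArithmeticFunction.intCoe_apply, one_mul, add_zero]
  rw [hcast, Complex.norm_real] at key
  -- split off the term `n = 1`
  have hsplit : (∑ n ∈ Icc 1 x, (ArithmeticFunction.moebius n *
        ArithmeticFunction.moebius (n + h) : ℝ) / n)
      = (ArithmeticFunction.moebius 1 * ArithmeticFunction.moebius (1 + h) : ℝ) / (1 : ℕ)
        + ∑ n ∈ Ioc 1 x, (ArithmeticFunction.moebius n *
          ArithmeticFunction.moebius (n + h) : ℝ) / n := by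
    rw [← Finset.Ioc_insert_left hx4, Finset.sum_insert Finset.left_notMem_Ioc]
  have hfirst : ‖(ArithmeticFunction.moebius 1 * ArithmeticFunction.moebius (1 + h) : ℝ) /
      (1 : ℕ)‖ ≤ 1 := by
    rw [Nat.cast_one, div_one, norm_mul]
    have b1 : |(ArithmeticFunction.moebius 1 : ℝ)| ≤ 1 := by
      exact_mod_cast ArithmeticFunction.abs_moebius_le_one
    have b2 : |(ArithmeticFunction.moebius (1 + h) : ℝ)| ≤ 1 := by
      exact_mod_cast ArithmeticFunction.abs_moebius_le_one
    rw [← Real.norm_eq_abs] at b1 b2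
    exact mul_le_one₀ b1 (norm_nonneg _) b2
  have hlog : 0 ≤ Real.log (x : ℝ) := Real.log_natCast_nonneg x
  have hclog : 1 ≤ c / 2 * Real.log (x : ℝ) := by
    rw [div_le_iff₀ hc] at hx3
    linarith
  rw [hsplit, Real.norm_of_nonneg hlog]
  calc ‖(ArithmeticFunction.moebius 1 * ArithmeticFunction.moebius (1 + h) : ℝ) / (1 : ℕ)
        + ∑ n ∈ Ioc 1 x, (ArithmeticFunction.moebius n *
          ArithmeticFunction.moebius (n + h) : ℝ) / n‖
      ≤ 1 + c / 2 * Real.log (x : ℝ) := (norm_add_le _ _).trans (add_le_add hfirst key)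
    _ ≤ c * Real.log (x : ℝ) := by linarith

/-- The same reduction phrased with the `μ`-hypothesis: Theorem 1.3 and hypothesis (1.6) for `μ`
imply the Möbius two-point estimate. [cite: TaoFMP2016, §1, paragraph after Remark 1.6; Theorem 1.3] -/
theorem tao_log_chowla_moebius_of_elliott' (hE : tao_log_averaged_elliott_two)
    (hM0 : Tao2016_moebiusNonpretentious) : Sieve.tao_log_chowla_moebius :=
  LFunctions.tao_log_chowla_moebius_of_elliott hE (Tao2016_moebiusNonpretentious_iff.1 hM0)

/-- The two named facts `tao_log_averaged_elliott_two` (Tao 2016, Thm 1.3) and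
`MatomakiRadziwillTao2015_liouvilleDistLowerBound` (MRT 2015, (1.12)) together imply
`Literature.NumberTheory.Sieve.tao_log_chowla_moebius` — the same two leaves as for
`Literature.NumberTheory.LFunctions.tao_log_chowla_liouville_of_facts`.
[cite: TaoFMP2016, §1, paragraph after Remark 1.6; Theorem 1.3] -/
theorem tao_log_chowla_moebius_of_facts (hE : tao_log_averaged_elliott_two)
    (hM : MatomakiRadziwillTao2015_liouvilleDistLowerBound) : Sieve.tao_log_chowla_moebius :=
  LFunctions.tao_log_chowla_moebius_of_elliott hE (Tao2016_liouvilleNonpretentious_of_MRT hM)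

/-- The current proof frontier one layer deeper: Tao 2016, Theorem 2.3 (`Tao2016_theorem23`), the
§2 reduction Theorem 2.3 ⇒ Theorem 1.3 (`Tao2016_section2_reduction`) and MRT (1.12) imply
`Literature.NumberTheory.Sieve.tao_log_chowla_moebius`. [cite: TaoFMP2016, §2 (first paragraph) and Theorem 2.3] -/
theorem tao_log_chowla_moebius_of_theorem23 (hred : Tao2016_section2_reduction)
    (h23 : Tao2016_theorem23) (hM : MatomakiRadziwillTao2015_liouvilleDistLowerBound) :
    Sieve.tao_log_chowla_moebius :=
  LFunctions.tao_log_chowla_moebius_of_facts (tao_log_averaged_elliott_two_of_theorem23 hred h23) hM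

end Literature.NumberTheory.LFunctions
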